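import Summits.QuantumFields.YangMills.Theorems.UnitScaleTiltProp7OneShotAxialFrameRows
import Summits.QuantumFields.YangMills.Theorems.UnitScaleTiltProp7CovariantTentPointwise
import Summits.QuantumFields.YangMills.Theorems.UnitScaleTiltProp7TentWeightsZd
import Summits.QuantumFields.YangMills.Theorems.UnitScaleTiltProp7CoarseStaircaseTelescoping
import HarnessLib

/-!
# Route `UnitScaleTilt`, crux K1 «MinimiserStabilityRegPr» (stmt-QuantumFields-19200) — route-R E′ (A′), LANE II «DIVERGENCE RECOVERY AT CURVED `W`» (★★OWNER RULING №23),
# brick (B2a), sub-pen F4 (★p1 g19 NAMER WORD №6 (3)), FILE F4-B1: **THE COVARIANT TENT QUASI-INTERPOLANT `I_σ` OF `QprimeCombL2 W` AT THE MEMBER — CONSTRUCTION, POINTWISE ROW,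
# AVERAGING IDENTITY, SIZE ROW**

Cell `ym3-torus` ∕ width seat `ym3-torus-px3` (gen 6).  THEOREMS ONLY (0 `def`, 0 `sorry`); `--supports stmt-QuantumFields-19200 --as helper`, count-neutral.  YM₃ on T³ is a ladder rung (R3),
not d = 4, not the Clay problem; nothing here claims [Balaban1985BackgroundPropagators] Thm 3.11, `hN06`, (REC), E′, EX or the gap.

THE OBJECT (★p1 g19 SIGNATURE-0 (B2a) «`J := I_σ + J⁰_σ∘N∘(1 − Q′I_σ)`»; frame letter FROZEN by NAMER WORD №6 (2)).  Member `F`, `n ≤ K`, `k := K − n`, `ℓ := Lᵏ`, weight `c₀`, `x₀ := basePt F n K`,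
`W♯ := pull (bgUnits F K W) x₀`, `Y z := (blockMap L)^[k] z`, `N_k := (F.P K).sitesPerDir k`.  For a coarse function `w : Site (F.P K) k → M₂` the interpolant is, at the torus site `transl x₀ z`,
`(I w)(transl x₀ z) = Σ_{δ : Fin 3 → Fin 2} Θ(Y z − δ, z) • Ad(axialFn W♯ (blockBase ℓ (Y z − δ)) z)⁻¹ (w (tcls N_k (Y z − δ)))` — the tensor TENT weights of ✓`Prop7TentWeightsZd`
(`Θ(Y′, z) = Π_i max 0 (1 − |z i − ℓY′ i − ℓ|∕ℓ)`, a p.o.u. over the eight boxes below `z`) times the values of `w` at those boxes transported to `z` by the ONE-SHOT AXIAL frames from the box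
corners (★p1's `σ_W` is the `δ = 0` frame).

CONTENTS (ns `…Theorems.Prop7TentQuasiInterpolantCore`):
* §1 `tentTerm_isPeriodic` (each `δ`-term is `N₀`-periodic on `ℤ³`: lit ✓`iterate_blockMap_add_period`, px15 ✓`axialFn_add_period`, `tcls_period`), ★★★ `exists_tentQuasiInterpolant_core` — a ℂ-LINEAR
  `I` with the POINTWISE row and the AVERAGING IDENTITY `Q′_W(I w)(y) = Σ_{x ∈ blockIter L k (tlift y)} ((L³)⁻¹)ᵏ • Ad(τ_W(tlift y, x))(I w)(x)` (lit ✓`QprimeIter_zd_eq_sum_blockIter`, as ✓`exists_bumpSection`).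
* §2 ★★ `norm_sq_toL2S_tent_le` — the SIZE row `‖toL2S l‖² ≤ 16·(c₀ℓ³·Σ_y ‖w y‖²)` for every `l` with the pointwise description (✓`norm_sq_covTent_le` pointwise, `Θ ≤ 1`, ✓`sum_site_comp_boxOf`,
  translation invariance on the coarse torus; Frobenius vs operator norm costs `2`, the eight boxes `8`).
HONEST SCOPE.  Construction + bookkeeping; the GRADIENT and REPRODUCTION rows are FILE F4-B2; nothing of print estimated; rung R3, not Clay; YM gap NOT proved.

References: T. Bałaban, CMP **99** (1985) 389–434 [Balaban1985BackgroundPropagators] ((3.11) p.392, (3.17)–(3.19) p.393); CMP **98** (1985) 17–51 [Balaban1985Averaging] ((52)–(53) p.27, pp.24–25);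
CMP **99** (1985) 75–102 [Balaban1985RegularSpaces] ((1.3), (1.7) p.77).
-/

set_option autoImplicit false

noncomputable section

open scoped InnerProductSpace Matrix.Norms.L2Operator BigOperators

namespace Summit.QuantumFields.YangMills.Theorems.Prop7TentQuasiInterpolantCore

open Literature.MathematicalPhysics.QuantumFieldTheory.Balaban1983to89
open Literature.MathematicalPhysics.QuantumFieldTheory.Balaban1983to89.T3ContinuumYM3Torus
open Literature.MathematicalPhysics.QuantumLattice (blockMap blockBase)
open B7Prop1Explicit renaming Site → LSite
open B7Prop1Explicit (U1 axialFn axialFn_mem e)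
open B7Eq78Linearization (conjR conjR_apply conjR_add conjR_smul_real)
open B8Ineq132 (conjR_conjR conjR_sum norm_conjR)
open B8Eq119TwistedAxial (bgT)
open B9B8AveragingKernelZd (blockIter mem_blockIter_iff compT QprimeIter_zd_eq_sum_blockIter card_blockIter)
open B9Eq325QprimeSingleSiteZd (blockMapIter_eq_blockMap_pow)
open B9Thm31GpAgmonDecayCoarseZd (blockMapIter_eq_iterate)
open B10Eq27TorusAxialLog (transl transl_apply pull pull_apply)
open T4TermwiseTorus (IsPeriodic tcls tlift tcls_tlift tcls_add tcls_period tcls_apply box mem_box tlift_tcls_of_mem_box)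
open T3SectALandauChart (bgUnits)
open B11Eq103H1Complex (SiteL2K)
open Summit.QuantumFields.YangMills.Theorems.Prop7SectET3Transport (periodsT3)
open Summit.QuantumFields.YangMills.Theorems.Prop7SectET3HilbertLetters (W₂ frobEquiv toL2S)
open Summit.QuantumFields.YangMills.Theorems.Prop7SPrint (basePt)
open Summit.QuantumFields.YangMills.Theorems.Prop7QprimeCombL2 (QprimeCombL2 QprimeCombL2_apply sitesPerDir_zero_eq comp_transl_descend)
open Summit.QuantumFields.YangMills.Theorems.Prop7QprimeCombBumpSection (iterate_blockMap_add_period)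
open Summit.QuantumFields.YangMills.Theorems.Prop7QprimeCombBumpSectionRows (sum_site_comp_boxOf transl_tlift_sub)
open Summit.QuantumFields.YangMills.Theorems.Prop7OneShotAxialFrameRows (axialFn_add_period)
open Summit.QuantumFields.YangMills.Theorems.Prop7LandauCombDict (transl_add_period)
open Summit.QuantumFields.YangMills.Theorems.Prop7RieszTauFrobNorm (norm_frobEquiv_symm_le)
open Summit.QuantumFields.YangMills.Theorems.Prop7CovariantTentPointwise (norm_sq_covTent_le)
open Summit.QuantumFields.YangMills.Theorems.Prop7TentWeightsZd (tensorTent_nonneg tensorTent_le_one sum_tensorTent_boxes_eq_one)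
open Summit.QuantumFields.YangMills.Theorems.Prop7CoarseStaircaseTelescoping (sum_comp_transl_eq)

/-! ## §1 The interpolant: periodicity of the `δ`-terms, construction, pointwise row, averaging identity -/

section Member

variable (F : T3Family) (n K : ℕ) (c₀ : ℝ)

/-- `blockBase` is additive. [folklore] -/
theorem blockBase_sub {d : ℕ} (M : ℕ) (a b : LSite d) : blockBase M (a - b) = blockBase M a - blockBase M b := by
  funext i; simp only [blockBase, Pi.sub_apply, mul_sub]

/-- **EACH `δ`-TERM OF THE INTERPOLANT IS `N₀`-PERIODIC ON `ℤ³`** (`N₀ = ℓ·N_k`): the tent argument `z − ℓ(Y z − δ)` is invariant (the box label moves by `N_k·m`), the frame is invariant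
(px15 ✓`axialFn_add_period`, `W♯` periodic), the coarse value is invariant (`tcls_period`). [cite: Balaban1985RegularSpaces, (1.3) p.77; Balaban1985Averaging, (43) p.24] -/
theorem tentTerm_isPeriodic (hnK : n ≤ K) (W : GaugeField (F.P K) 0 (Matrix.specialUnitaryGroup (Fin 2) ℂ)) (w : Site (F.P K) (K - n) → Matrix (Fin 2) (Fin 2) ℂ)
    (δ : Fin (F.P K).d → Fin 2) :
    IsPeriodic ((F.P K).sitesPerDir 0) (fun z : LSite (F.P K).d =>
      (∏ i : Fin (F.P K).d, max 0 (1 - |((z i - ((F.P K).L ^ (K - n) : ℕ) * (((blockMap (F.P K).L)^[K - n] z - fun i => ((δ i : ℕ) : ℤ)) i) : ℤ) : ℝ)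
          - (((F.P K).L ^ (K - n) : ℕ) : ℝ)| / (((F.P K).L ^ (K - n) : ℕ) : ℝ))) •
        conjR (axialFn (pull (bgUnits F K W) (basePt F n K)) (blockBase ((F.P K).L ^ (K - n)) ((blockMap (F.P K).L)^[K - n] z - fun i => ((δ i : ℕ) : ℤ))) z)⁻¹
          (w (tcls ((F.P K).sitesPerDir (K - n)) ((blockMap (F.P K).L)^[K - n] z - fun i => ((δ i : ℕ) : ℤ))))) := by
  haveI : NeZero (F.P K).L := ⟨by have h := F.hL.2; show F.L ≠ 0; omega⟩
  intro z m
  have hper : IsPeriodic ((F.P K).sitesPerDir 0) (pull (bgUnits F K W) (basePt F n K)) := fun z m' => by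
    funext μ; rw [pull_apply, pull_apply, transl_add_period]
  set Nk := (F.P K).sitesPerDir (K - n) with hNk
  set ℓ := (F.P K).L ^ (K - n) with hℓ
  have hN0 : (F.P K).sitesPerDir 0 = ℓ * Nk := sitesPerDir_zero_eq F n K hnK
  -- the box label moves by `N_k • m`
  have hY : (blockMap (F.P K).L)^[K - n] (z + (((F.P K).sitesPerDir 0 : ℕ) : ℤ) • m) = (blockMap (F.P K).L)^[K - n] z + ((Nk : ℕ) : ℤ) • m := by
    rw [hN0]; exact iterate_blockMap_add_period (F.P K).L (K - n) Nk z m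
  simp only []
  rw [hY]
  -- (a) tent argument invariant
  have harg : ∀ i : Fin (F.P K).d, (z + (((F.P K).sitesPerDir 0 : ℕ) : ℤ) • m) i - (ℓ : ℕ) * (((blockMap (F.P K).L)^[K - n] z + ((Nk : ℕ) : ℤ) • m - fun i => ((δ i : ℕ) : ℤ)) i)
      = z i - (ℓ : ℕ) * (((blockMap (F.P K).L)^[K - n] z - fun i => ((δ i : ℕ) : ℤ)) i) := by
    intro i
    simp only [Pi.add_apply, Pi.sub_apply, Pi.smul_apply, smul_eq_mul, hN0, Nat.cast_mul]
    ring
  simp only [harg]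
  -- (b) frame invariant, (c) coarse value invariant
  have hroot : blockBase ℓ ((blockMap (F.P K).L)^[K - n] z + ((Nk : ℕ) : ℤ) • m - fun i => ((δ i : ℕ) : ℤ))
      = blockBase ℓ ((blockMap (F.P K).L)^[K - n] z - fun i => ((δ i : ℕ) : ℤ)) + (((F.P K).sitesPerDir 0 : ℕ) : ℤ) • m := by
    funext i
    simp only [blockBase, Pi.add_apply, Pi.sub_apply, Pi.smul_apply, smul_eq_mul, hN0, Nat.cast_mul]
    ring
  have hframe : axialFn (pull (bgUnits F K W) (basePt F n K)) (blockBase ℓ ((blockMap (F.P K).L)^[K - n] z + ((Nk : ℕ) : ℤ) • m - fun i => ((δ i : ℕ) : ℤ)))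
        (z + (((F.P K).sitesPerDir 0 : ℕ) : ℤ) • m)
      = axialFn (pull (bgUnits F K W) (basePt F n K)) (blockBase ℓ ((blockMap (F.P K).L)^[K - n] z - fun i => ((δ i : ℕ) : ℤ))) z := by
    rw [hroot]; exact axialFn_add_period _ hper _ _ _
  have hval : tcls Nk ((blockMap (F.P K).L)^[K - n] z + ((Nk : ℕ) : ℤ) • m - fun i => ((δ i : ℕ) : ℤ))
      = tcls Nk ((blockMap (F.P K).L)^[K - n] z - fun i => ((δ i : ℕ) : ℤ)) := by
    rw [show (blockMap (F.P K).L)^[K - n] z + ((Nk : ℕ) : ℤ) • m - (fun i => ((δ i : ℕ) : ℤ))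
        = ((blockMap (F.P K).L)^[K - n] z - fun i => ((δ i : ℕ) : ℤ)) + ((Nk : ℕ) : ℤ) • m by abel, tcls_add, tcls_period, add_zero]
  rw [hframe, hval]

/-- ★★★ **THE COVARIANT TENT QUASI-INTERPOLANT — CONSTRUCTION, POINTWISE ROW, AVERAGING IDENTITY.**  For every member, `n ≤ K`, weight `c₀` and background `W` there is a ℂ-linear
`I : (coarse functions) →ₗ SiteL2K` with (POINTWISE) `toL2S⁻¹(I w)(transl x₀ z) = Σ_δ Θ(Y z − δ, z) • Ad(axialFn W♯ (blockBase ℓ (Y z − δ)) z)⁻¹ (w (tcls N_k (Y z − δ)))` and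
(AVERAGING) `Q′_W(I w)(y) = Σ_{x ∈ blockIter L k (tlift y)} ((Lᵈ)⁻¹)ᵏ • Ad(τ_W(tlift y, x)) (toL2S⁻¹(I w)(transl x₀ x))`, `τ_W = compT L (bgT L W♯) k`.
[cite: Balaban1985BackgroundPropagators, (3.17)-(3.19) p.393; Balaban1985Averaging, (52)-(53) p.27] -/
theorem exists_tentQuasiInterpolant_core (hnK : n ≤ K) (W : GaugeField (F.P K) 0 (Matrix.specialUnitaryGroup (Fin 2) ℂ)) :
    ∃ I : (Site (F.P K) (K - n) → Matrix (Fin 2) (Fin 2) ℂ) →ₗ[ℂ] SiteL2K ℂ 3 (periodsT3 F K) c₀ W₂,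
      (∀ (w : Site (F.P K) (K - n) → Matrix (Fin 2) (Fin 2) ℂ) (z : LSite (F.P K).d),
        (toL2S F K c₀).symm (I w) (transl (basePt F n K) z)
          = ∑ δ : Fin (F.P K).d → Fin 2,
              (∏ i : Fin (F.P K).d, max 0 (1 - |((z i - ((F.P K).L ^ (K - n) : ℕ) * (((blockMap (F.P K).L)^[K - n] z - fun i => ((δ i : ℕ) : ℤ)) i) : ℤ) : ℝ)
                  - (((F.P K).L ^ (K - n) : ℕ) : ℝ)| / (((F.P K).L ^ (K - n) : ℕ) : ℝ))) •
                conjR (axialFn (pull (bgUnits F K W) (basePt F n K)) (blockBase ((F.P K).L ^ (K - n)) ((blockMap (F.P K).L)^[K - n] z - fun i => ((δ i : ℕ) : ℤ))) z)⁻¹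
                  (w (tcls ((F.P K).sitesPerDir (K - n)) ((blockMap (F.P K).L)^[K - n] z - fun i => ((δ i : ℕ) : ℤ))))) ∧
      (∀ (w : Site (F.P K) (K - n) → Matrix (Fin 2) (Fin 2) ℂ) (y : Site (F.P K) (K - n)),
        QprimeCombL2 F n K c₀ W (I w) y
          = ∑ x ∈ blockIter (F.P K).L (K - n) (tlift y),
              ((((F.P K).L : ℝ) ^ (F.P K).d)⁻¹) ^ (K - n) •
                conjR (compT (F.P K).L (bgT (F.P K).L (pull (bgUnits F K W) (basePt F n K))) (K - n) (tlift y) x)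
                  ((toL2S F K c₀).symm (I w) (transl (basePt F n K) x))) := by
  haveI : NeZero (F.P K).L := ⟨by have h := F.hL.2; show F.L ≠ 0; omega⟩
  set Nk : ℕ := (F.P K).sitesPerDir (K - n) with hNk
  set ℓ : ℕ := (F.P K).L ^ (K - n) with hℓ
  -- the `ℤ³` function
  set G : (Site (F.P K) (K - n) → Matrix (Fin 2) (Fin 2) ℂ) → LSite (F.P K).d → Matrix (Fin 2) (Fin 2) ℂ :=
    fun w z => ∑ δ : Fin (F.P K).d → Fin 2,
      (∏ i : Fin (F.P K).d, max 0 (1 - |((z i - (ℓ : ℕ) * (((blockMap (F.P K).L)^[K - n] z - fun i => ((δ i : ℕ) : ℤ)) i) : ℤ) : ℝ) - ((ℓ : ℕ) : ℝ)| / ((ℓ : ℕ) : ℝ))) •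
        conjR (axialFn (pull (bgUnits F K W) (basePt F n K)) (blockBase ℓ ((blockMap (F.P K).L)^[K - n] z - fun i => ((δ i : ℕ) : ℤ))) z)⁻¹
          (w (tcls Nk ((blockMap (F.P K).L)^[K - n] z - fun i => ((δ i : ℕ) : ℤ)))) with hG
  have hper : ∀ w, IsPeriodic ((F.P K).sitesPerDir 0) (G w) := by
    intro w z m
    simp only [hG]
    refine Finset.sum_congr rfl fun δ _ => ?_
    exact tentTerm_isPeriodic F n K hnK W w δ z m
  -- linearity in `w`
  let Λ : (Site (F.P K) (K - n) → Matrix (Fin 2) (Fin 2) ℂ) →ₗ[ℂ] (Site (F.P K) 0 → Matrix (Fin 2) (Fin 2) ℂ) :=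
    { toFun := fun w x => G w (tlift (fun κ => x κ - basePt F n K κ))
      map_add' := fun u v => by
        funext x; simp only [hG, Pi.add_apply]
        rw [← Finset.sum_add_distrib]
        refine Finset.sum_congr rfl fun δ _ => ?_
        rw [conjR_add, smul_add]
      map_smul' := fun c u => by
        funext x; simp only [hG, Pi.smul_apply, RingHom.id_apply, Finset.smul_sum]
        refine Finset.sum_congr rfl fun δ _ => ?_
        rw [show conjR _ (c • u _) = c • conjR _ (u _) by rw [conjR_apply, conjR_apply, Matrix.mul_smul, Matrix.smul_mul], smul_comm] }
  set I : (Site (F.P K) (K - n) → Matrix (Fin 2) (Fin 2) ℂ) →ₗ[ℂ] SiteL2K ℂ 3 (periodsT3 F K) c₀ W₂ := (toL2S F K c₀).toLinearMap ∘ₗ Λ with hI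
  have hpt : ∀ (w : Site (F.P K) (K - n) → Matrix (Fin 2) (Fin 2) ℂ) (z : LSite (F.P K).d), (toL2S F K c₀).symm (I w) (transl (basePt F n K) z) = G w z := by
    intro w z
    rw [hI, LinearMap.comp_apply, LinearEquiv.coe_toLinearMap, LinearEquiv.symm_apply_apply]
    exact comp_transl_descend (basePt F n K) (hper w) z
  refine ⟨I, fun w z => hpt w z, fun w y => ?_⟩
  rw [QprimeCombL2_apply]
  have hfun : (fun z => (toL2S F K c₀).symm (I w) (transl (basePt F n K) z)) = G w := funext (hpt w)
  rw [hfun, QprimeIter_zd_eq_sum_blockIter]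
  refine Finset.sum_congr rfl fun x _ => ?_
  rw [hpt w x]

/-! ## §2 The SIZE row -/

variable {F n K c₀}
variable [Fact (0 < c₀)]

/-- ★★ **THE SIZE ROW OF THE COVARIANT TENT**: for every `l` with the pointwise description, `‖toL2S l‖² ≤ 16·(c₀ℓ³·Σ_y ‖w y‖²)` (`2` Frobenius vs operator norm × `8` boxes; `Θ ≤ 1` and
convexity `Σ_δ Θ = 1` pointwise by ✓`norm_sq_covTent_le`). [cite: Balaban1985BackgroundPropagators, (3.11) p.392, (3.19) p.393] -/
theorem norm_sq_toL2S_tent_le (hnK : n ≤ K) (W : GaugeField (F.P K) 0 (Matrix.specialUnitaryGroup (Fin 2) ℂ))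
    (w : Site (F.P K) (K - n) → Matrix (Fin 2) (Fin 2) ℂ) (l : Site (F.P K) 0 → Matrix (Fin 2) (Fin 2) ℂ)
    (hl : ∀ z : LSite (F.P K).d, l (transl (basePt F n K) z)
      = ∑ δ : Fin (F.P K).d → Fin 2,
          (∏ i : Fin (F.P K).d, max 0 (1 - |((z i - ((F.P K).L ^ (K - n) : ℕ) * (((blockMap (F.P K).L)^[K - n] z - fun i => ((δ i : ℕ) : ℤ)) i) : ℤ) : ℝ)
              - (((F.P K).L ^ (K - n) : ℕ) : ℝ)| / (((F.P K).L ^ (K - n) : ℕ) : ℝ))) •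
            conjR (axialFn (pull (bgUnits F K W) (basePt F n K)) (blockBase ((F.P K).L ^ (K - n)) ((blockMap (F.P K).L)^[K - n] z - fun i => ((δ i : ℕ) : ℤ))) z)⁻¹
              (w (tcls ((F.P K).sitesPerDir (K - n)) ((blockMap (F.P K).L)^[K - n] z - fun i => ((δ i : ℕ) : ℤ))))) :
    ‖toL2S F K c₀ l‖ ^ 2 ≤ 16 * (c₀ * ((F.L : ℝ) ^ (K - n)) ^ 3 * ∑ y : Site (F.P K) (K - n), ‖w y‖ ^ 2) := by
  haveI : NeZero (F.P K).L := ⟨by have h := F.hL.2; show F.L ≠ 0; omega⟩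
  have hc₀ : 0 < c₀ := Fact.out
  set Nk : ℕ := (F.P K).sitesPerDir (K - n) with hNk
  set ℓ : ℕ := (F.P K).L ^ (K - n) with hℓ
  have hℓpos : 0 < ℓ := pos_iff_ne_zero.mpr (pow_ne_zero _ (NeZero.ne _))
  have hit : ∀ x : LSite (F.P K).d, (blockMap (F.P K).L)^[K - n] x = blockMap ℓ x := fun x => by
    rw [← blockMapIter_eq_iterate (F.P K).L (K - n) x, blockMapIter_eq_blockMap_pow]
  have hV : ∀ x κ, pull (bgUnits F K W) (basePt F n K) x κ ∈ U1 (Matrix (Fin 2) (Fin 2) ℂ) :=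
    fun x κ => Prop7QprimeCombBumpSectionRows.pull_bgUnits_mem_U1 W (basePt F n K) x κ
  -- `‖toL2S l‖² = c₀ Σ_x ‖frobEquiv⁻¹(l x)‖²`
  have hnorm : ‖toL2S F K c₀ l‖ ^ 2 = c₀ * ∑ x : Site (F.P K) 0, ‖(frobEquiv.symm (l x) : W₂)‖ ^ 2 := by
    have h := Summit.QuantumFields.YangMills.Theorems.Prop7SectET3RealCoordSums.inner_toL2S (F := F) (K := K) (c₀ := c₀) l l
    rw [← inner_self_eq_norm_sq (𝕜 := ℂ), h]
    simp only [RCLike.re_to_complex, Complex.re_ofReal_mul]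
    congr 1
    rw [Complex.re_sum]
    refine Finset.sum_congr rfl fun x _ => ?_
    rw [← Summit.QuantumFields.YangMills.Theorems.Prop7SectET3HilbertLetters.inner_frobEquiv_symm, ← inner_self_eq_norm_sq (𝕜 := ℂ)]
    rfl
  -- the coarse-site function `M(y) := Σ_δ ‖w(y − δ)‖²`
  set M : Site (F.P K) (K - n) → ℝ := fun y => ∑ δ : Fin (F.P K).d → Fin 2, ‖w (transl y (-fun i => ((δ i : ℕ) : ℤ)))‖ ^ 2 with hM
  -- pointwise: `‖frobEquiv⁻¹(l x)‖² ≤ 2·M(y(x))`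
  have hpt : ∀ x : Site (F.P K) 0, ‖(frobEquiv.symm (l x) : W₂)‖ ^ 2
      ≤ 2 * M (tcls Nk ((blockMap (F.P K).L)^[K - n] (tlift (fun κ => x κ - basePt F n K κ)))) := by
    intro x
    set z := tlift (fun κ => x κ - basePt F n K κ) with hz
    have hx : x = transl (basePt F n K) z := (transl_tlift_sub (basePt F n K) x).symm
    have h1 : ‖(frobEquiv.symm (l x) : W₂)‖ ≤ Real.sqrt 2 * ‖l x‖ := norm_frobEquiv_symm_le _
    -- the operator-norm bound by `norm_sq_covTent_le`
    have h2 : ‖l x‖ ^ 2 ≤ M (tcls Nk ((blockMap (F.P K).L)^[K - n] z)) := by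
      rw [hx, hl z]
      have hβ1 : ∑ δ : Fin (F.P K).d → Fin 2,
          (∏ i : Fin (F.P K).d, max 0 (1 - |((z i - (ℓ : ℕ) * (((blockMap (F.P K).L)^[K - n] z - fun i => ((δ i : ℕ) : ℤ)) i) : ℤ) : ℝ) - ((ℓ : ℕ) : ℝ)| / ((ℓ : ℕ) : ℝ))) = 1 := by
        rw [hit]; exact sum_tensorTent_boxes_eq_one hℓpos z
      have h := norm_sq_covTent_le (Finset.univ : Finset (Fin (F.P K).d → Fin 2))
        (fun δ => ∏ i : Fin (F.P K).d, max 0 (1 - |((z i - (ℓ : ℕ) * (((blockMap (F.P K).L)^[K - n] z - fun i => ((δ i : ℕ) : ℤ)) i) : ℤ) : ℝ) - ((ℓ : ℕ) : ℝ)| / ((ℓ : ℕ) : ℝ)))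
        (fun δ _ => tensorTent_nonneg ℓ _) hβ1
        (fun δ => axialFn (pull (bgUnits F K W) (basePt F n K)) (blockBase ℓ ((blockMap (F.P K).L)^[K - n] z - fun i => ((δ i : ℕ) : ℤ))) z)
        (fun δ _ => axialFn_mem hV _ _)
        (fun δ => w (tcls Nk ((blockMap (F.P K).L)^[K - n] z - fun i => ((δ i : ℕ) : ℤ))))
      refine h.trans ?_
      rw [hM]
      refine Finset.sum_le_sum fun δ _ => ?_
      have hval : tcls Nk ((blockMap (F.P K).L)^[K - n] z - fun i => ((δ i : ℕ) : ℤ)) = transl (tcls Nk ((blockMap (F.P K).L)^[K - n] z)) (-fun i => ((δ i : ℕ) : ℤ)) := by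
        funext ν; simp only [transl_apply, tcls_apply, Pi.sub_apply, Pi.neg_apply]; push_cast; ring
      rw [hval]
      calc _ ≤ 1 * ‖w (transl (tcls Nk ((blockMap (F.P K).L)^[K - n] z)) (-fun i => ((δ i : ℕ) : ℤ)))‖ ^ 2 :=
            mul_le_mul_of_nonneg_right (tensorTent_le_one ℓ _) (sq_nonneg _)
        _ = _ := one_mul _
    calc ‖(frobEquiv.symm (l x) : W₂)‖ ^ 2 ≤ (Real.sqrt 2 * ‖l x‖) ^ 2 := pow_le_pow_left₀ (norm_nonneg _) h1 2
      _ = 2 * ‖l x‖ ^ 2 := by rw [mul_pow, Real.sq_sqrt (by norm_num)]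
      _ ≤ 2 * M (tcls Nk ((blockMap (F.P K).L)^[K - n] z)) := by gcongr
  rw [hnorm]
  have hsum := Finset.sum_le_sum fun x (_ : x ∈ Finset.univ) => hpt x
  rw [← Finset.mul_sum, sum_site_comp_boxOf F n K hnK M] at hsum
  have hLd : ((((F.P K).L ^ (F.P K).d) ^ (K - n) : ℕ) : ℝ) = ((F.L : ℝ) ^ (K - n)) ^ 3 := by
    rw [show (F.P K).d = 3 from T3Family.P_d F K, show (F.P K).L = F.L from rfl]; push_cast; ring
  rw [nsmul_eq_mul, hLd] at hsum
  -- `Σ_y M(y) = 8 Σ_y ‖w y‖²`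
  have hMsum : ∑ y : Site (F.P K) (K - n), M y = 2 ^ (F.P K).d * ∑ y : Site (F.P K) (K - n), ‖w y‖ ^ 2 := by
    rw [hM, Finset.sum_comm]
    rw [Finset.sum_congr rfl fun δ _ => sum_comp_transl_eq (-fun i => ((δ i : ℕ) : ℤ)) (fun y => ‖w y‖ ^ 2), Finset.sum_const, Finset.card_univ, nsmul_eq_mul,
      Fintype.card_fun, Fintype.card_fin, Fintype.card_fin]
    push_cast; ring
  have hd : (2 : ℝ) ^ (F.P K).d = 8 := by rw [show (F.P K).d = 3 from T3Family.P_d F K]; norm_num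
  rw [hMsum, hd] at hsum
  calc c₀ * ∑ x : Site (F.P K) 0, ‖(frobEquiv.symm (l x) : W₂)‖ ^ 2 ≤ c₀ * (2 * (((F.L : ℝ) ^ (K - n)) ^ 3 * (8 * ∑ y : Site (F.P K) (K - n), ‖w y‖ ^ 2))) :=
        mul_le_mul_of_nonneg_left hsum hc₀.le
    _ = 16 * (c₀ * ((F.L : ℝ) ^ (K - n)) ^ 3 * ∑ y : Site (F.P K) (K - n), ‖w y‖ ^ 2) := by ring

end Member

end Summit.QuantumFields.YangMills.Theorems.Prop7TentQuasiInterpolantCore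

end
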